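import Summits.QuantumFields.YangMills.Theorems.FluctuationComparisonRegPrIntLS2BetaQuaternionReadDerivKStepSup
import HarnessLib

/-!
# S2β · Q10 — (D2) AT THE ORGAN IN LOCAL-SUP FORM AND SUMMED OVER COARSE BONDS: `‖(DMq_{J←K}(U₀) y)(B)‖ ≤ A·L^{K−J}·‖y^{(B)}‖_∞`, `Σ_B ‖(DMq y)(B)‖ ≤ A·L^{K−J}·Σ_B ‖y^{(B)}‖_∞`

Cell `ym3-torus` (rung R3 = continuum `SU(2)` YM₃ on T³ at fixed lattice data — NOT d = 4, NOT infinite volume, NOT a mass gap, NOT Clay).  Width seat `ym3-torus-px5` (gen 23);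
crux `stmt-QuantumFields-20520`, LINE g18-1 S2β, the local text of record `hLoc` (px16 g22 ✓p828403 `avg2_of_local`): its left side is `Σ_B ‖Σ_t (T_t bracket_t)(B)‖` by Q7
✓p827759 (`T_t := DMq_{J←J+t}(D_{J+t,K}U₀)`), each bracket priced by Q9b; what multiplies a bracket field `y` on the way up is the PROPAGATION `Σ_B ‖(T_t y)(B)‖`.  (H) ✓
`…QuaternionReadDerivKStepSup.norm_qfderiv_apply_le` bounds `‖(DMq y)(B)‖` by the GLOBAL sup `‖y‖_∞`; Q3 ✓p825936 `qfderiv_apply_eq_zero_of_forall` says `(DMq y)(B)` only reads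
`y` on the READ SET of `B` (fine bonds with both endpoints' `(K−J)`-blocks in `{σB₋, σB₊}`).  THIS FILE combines the two: the LOCAL-SUP form and its sum over coarse bonds — the
propagation letter in the «`Σ_B (local sup)`» currency that keeps both the smooth and the sparse regime honest (a global sup would cost the volume, an `ℓ¹` would cost the block).
`--kind proof --supports stmt-QuantumFields-20520 --as helper`, count-neutral, DEFINITION-FREE (0 `def`, 0 `instance`, 0 `notation`, 0 `sorry`, default heartbeats).

NOTATION.  `σB := bondShift (F.sitesPerDir_eq (K := J) (j := 0) (K′ := K) (j′ := K − J) _) B`; the READ SET of `B`: fine bonds `ℓ` with `blockIter (K−J) ℓ.src ∈ {σB.src, σB.tgt}` AND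
`blockIter (K−J) ℓ.tgt ∈ {σB.src, σB.tgt}`; the truncation `y^{(B)} ℓ := if (read-set condition) then y ℓ else 0` (written out with `if … then … else`).

WHAT IS PROVED (sorry-free; Q1's guard at `(J,K)`: `0 ≤ θ`, `(5L)²∕4·θ_i ≤ α ≤ 1∕24` on `J < i ≤ K`, `α < δ_{SU(2)}`, `157α < L⁻²`, `U₀ ∈ histGood θ K J`).
* §1 ★★`qfderiv_apply_eq_truncate` — **`(DMq y) B = (DMq y^{(B)}) B`** (Q3 locality + linearity).
* §2 ★★★`norm_qfderiv_apply_le_local` — **`‖(DMq y) B‖ ≤ (1 + 4(d+2))·exp(c₃·Σ_{i<K−J}(5L)²∕4·θ(K−i))·L^{K−J}·‖y^{(B)}‖_∞`** ((H) on `y^{(B)}`), `c₃ = (d+2)(422 + 1616(d+2))`;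
  ★★★`sum_norm_qfderiv_apply_le_local` — **`Σ_B ‖(DMq y) B‖ ≤ (same constant)·Σ_B ‖y^{(B)}‖_∞`**.

HONEST SCOPE.  Bookkeeping over (H)∕(D2) and Q3; nothing of Bałaban's beyond what (D2) carries ([Balaban1985Averaging] (139)–(147)); the read-set MULTIPLICITY count (each fine bond is
read by `≤ 2d` coarse bonds) and the two COUNTS of §89.4 are NOT here; `hLoc` ∕ TAYLOR♭_q ∕ AVG₂♭-ax_q, «MULT♭-ax», «CRIT-ax», (D-ax)∕(F-ax), GAP♯∘ (`stub_uniformFibreGapOrbit`, registry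
3732b7df UNTOUCHED), S2β, the five registered stubs, 20520, 19936, 19200, `YM3TorusSU2` NOT proved; no summit statement is proved by a helper; rung R3 — NOT d = 4, NOT infinite volume,
NOT a mass gap, NOT Clay; the Yang–Mills mass gap is NOT proved.

References: T. Bałaban, CMP **98** (1985) 17–51 [Balaban1985Averaging] ((15) p.19, Prop. 3–4 pp.36–37, (139)–(147) pp.39–40); CMP **109** (1987) 249–301 [Balaban1987RG1] ((0.4), (0.11) p.253);
CMP **102** (1985) 255–275 [Balaban1985UV3] ((7) p.257, p.260).
-/

set_option autoImplicit false

noncomputable section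

open scoped BigOperators Matrix.Norms.L2Operator Topology
open Filter Set Function
open Literature.MathematicalPhysics.QuantumLattice (su2Quat)
open Literature.MathematicalPhysics.QuantumFieldTheory.Balaban1983to89
open Literature.MathematicalPhysics.QuantumFieldTheory.Balaban1983to89.HaarExponentialChart
open Literature.MathematicalPhysics.QuantumFieldTheory.Balaban1983to89.ExpMeanLog (expMeanLogSU deltaSU)
open Literature.MathematicalPhysics.QuantumFieldTheory.Balaban1983to89.Node00
open Literature.MathematicalPhysics.QuantumFieldTheory.Balaban1983to89.T3ContinuumYM3Torus
open Literature.MathematicalPhysics.QuantumFieldTheory.Balaban1983to89.T3UnitLawDensityEML (ℰp)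
open Literature.MathematicalPhysics.QuantumFieldTheory.Balaban1983to89.T3UnitScaleTilt
open Literature.MathematicalPhysics.QuantumFieldTheory.Balaban1983to89.T3TiltDescent
open Literature.MathematicalPhysics.QuantumFieldTheory.Balaban1983to89.T3LevelShift (fieldShift bondShift)
open Literature.MathematicalPhysics.QuantumFieldTheory.Balaban1983to89.T4HaarSU2ExpChart (expPoint)
open Literature.MathematicalPhysics.QuantumFieldTheory.Balaban1983to89.T4ExpWindowSmallField (imVec)
open Summit.QuantumFields.YangMills.Theorems.FluctuationComparisonRegPrIntLS2BetaQuaternionReadDictionary (qfderiv_apply_eq_zero_of_forall)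
open Summit.QuantumFields.YangMills.Theorems.FluctuationComparisonRegPrIntLS2BetaQuaternionReadDerivKStepSup (norm_qfderiv_apply_le)

namespace Summit.QuantumFields.YangMills.Theorems.FluctuationComparisonRegPrIntLS2BetaQuaternionReadDerivLocalSup

variable {F : T3Family}

/-! ## §1 `(DMq y) B` reads only the read set of `B` -/

section Truncate

/-- ★★ **`(DMq_{J←K}(U₀) y) B = (DMq_{J←K}(U₀) y^{(B)}) B`** with `y^{(B)}` the truncation of `y` to the read set of `B` (`y − y^{(B)}` vanishes on the read set, Q3
✓`qfderiv_apply_eq_zero_of_forall`, and `DMq` is linear). [cite: Balaban1985Averaging, (15) p.19; Balaban1987RG1, (0.4) p.253] -/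
theorem qfderiv_apply_eq_truncate {J K : ℕ} (hJK : J ≤ K) {θ : ℕ → ℝ} (hθ0 : ∀ i, 0 ≤ θ i) {α : ℝ}
    (hθα : ∀ i, J < i → i ≤ K → (((5 * F.L : ℕ) : ℝ) ^ 2 / 4) * θ i ≤ α)
    (hα24 : α ≤ 1 / 24) (hαδ : α < deltaSU (Fin 2)) (hαL : 157 * α < ((F.L : ℝ) ^ 2)⁻¹)
    {U₀ : GaugeField (F.P K) 0 (SU 2)} (hUg : U₀ ∈ histGood F ℰp θ K J)
    (y : PBond (F.P K) 0 → EuclideanSpace ℝ (Fin 3)) (B : PBond (F.P J) 0) :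
    fderiv ℝ (fun (ζ : PBond (F.P K) 0 → EuclideanSpace ℝ (Fin 3)) (B : PBond (F.P J) 0) =>
        imVec (su2Quat (descendTo F ℰp J K hJK (fun ℓ => expPoint (ζ ℓ) * U₀ ℓ) B * (descendTo F ℰp J K hJK U₀ B)⁻¹))) 0 y B =
      fderiv ℝ (fun (ζ : PBond (F.P K) 0 → EuclideanSpace ℝ (Fin 3)) (B : PBond (F.P J) 0) =>
        imVec (su2Quat (descendTo F ℰp J K hJK (fun ℓ => expPoint (ζ ℓ) * U₀ ℓ) B * (descendTo F ℰp J K hJK U₀ B)⁻¹))) 0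
        (fun ℓ => if
            (B14.Eq22Determines.blockIter (K - J) ℓ.src = (bondShift (F.sitesPerDir_eq (m := F.m) (K := J) (j := 0) (m' := F.m) (K' := K) (j' := K - J) (by omega)) B).src ∨
              B14.Eq22Determines.blockIter (K - J) ℓ.src = (bondShift (F.sitesPerDir_eq (m := F.m) (K := J) (j := 0) (m' := F.m) (K' := K) (j' := K - J) (by omega)) B).tgt) ∧
            (B14.Eq22Determines.blockIter (K - J) ℓ.tgt = (bondShift (F.sitesPerDir_eq (m := F.m) (K := J) (j := 0) (m' := F.m) (K' := K) (j' := K - J) (by omega)) B).src ∨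
              B14.Eq22Determines.blockIter (K - J) ℓ.tgt = (bondShift (F.sitesPerDir_eq (m := F.m) (K := J) (j := 0) (m' := F.m) (K' := K) (j' := K - J) (by omega)) B).tgt)
          then y ℓ else 0) B := by
  classical
  set σB := bondShift (F.sitesPerDir_eq (m := F.m) (K := J) (j := 0) (m' := F.m) (K' := K) (j' := K - J) (by omega)) B with hσB
  set y' : PBond (F.P K) 0 → EuclideanSpace ℝ (Fin 3) := fun ℓ => if
      (B14.Eq22Determines.blockIter (K - J) ℓ.src = σB.src ∨ B14.Eq22Determines.blockIter (K - J) ℓ.src = σB.tgt) ∧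
      (B14.Eq22Determines.blockIter (K - J) ℓ.tgt = σB.src ∨ B14.Eq22Determines.blockIter (K - J) ℓ.tgt = σB.tgt) then y ℓ else 0 with hy'
  have hvan : ∀ ℓ : PBond (F.P K) 0,
      (B14.Eq22Determines.blockIter (K - J) ℓ.src = σB.src ∨ B14.Eq22Determines.blockIter (K - J) ℓ.src = σB.tgt) →
      (B14.Eq22Determines.blockIter (K - J) ℓ.tgt = σB.src ∨ B14.Eq22Determines.blockIter (K - J) ℓ.tgt = σB.tgt) →
      (y - y') ℓ = 0 := fun ℓ h1 h2 => by
    simp only [Pi.sub_apply, hy', h1, h2, and_self, if_true, sub_self]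
  have hz := qfderiv_apply_eq_zero_of_forall (F := F) hJK hθ0 hθα hα24 hαδ hαL hUg (y - y') B hvan
  rw [map_sub, Pi.sub_apply, sub_eq_zero] at hz
  exact hz

end Truncate

/-! ## §2 The local-sup form of (D2) at the organ and its sum over coarse bonds -/

section LocalSup

/-- ★★★ **(D2) AT THE ORGAN, LOCAL-SUP FORM**: under Q1's guard at `(J,K)`,
`‖(DMq_{J←K}(U₀) y) B‖ ≤ (1 + 4(d+2))·exp(c₃·Σ_{i<K−J}(5L)²∕4·θ(K−i))·L^{K−J}·‖y^{(B)}‖_∞` — (H) ✓`norm_qfderiv_apply_le` applied to the read-set truncation.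
[cite: Balaban1985Averaging, (15) p.19, (139)-(147) pp.39-40; Balaban1987RG1, (0.4), (0.11) p.253; Balaban1985UV3, (7) p.257] -/
theorem norm_qfderiv_apply_le_local {J K : ℕ} (hJK : J ≤ K) {θ : ℕ → ℝ} (hθ0 : ∀ i, 0 ≤ θ i) {α : ℝ}
    (hθα : ∀ i, J < i → i ≤ K → (((5 * F.L : ℕ) : ℝ) ^ 2 / 4) * θ i ≤ α)
    (hα24 : α ≤ 1 / 24) (hαδ : α < deltaSU (Fin 2)) (hαL : 157 * α < ((F.L : ℝ) ^ 2)⁻¹)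
    {U₀ : GaugeField (F.P K) 0 (SU 2)} (hUg : U₀ ∈ histGood F ℰp θ K J)
    (y : PBond (F.P K) 0 → EuclideanSpace ℝ (Fin 3)) (B : PBond (F.P J) 0) :
    ‖fderiv ℝ (fun (ζ : PBond (F.P K) 0 → EuclideanSpace ℝ (Fin 3)) (B : PBond (F.P J) 0) =>
        imVec (su2Quat (descendTo F ℰp J K hJK (fun ℓ => expPoint (ζ ℓ) * U₀ ℓ) B * (descendTo F ℰp J K hJK U₀ B)⁻¹))) 0 y B‖ ≤
      (1 + 4 * (((F.P K).d + 2 : ℕ) : ℝ)) *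
          Real.exp ((((F.P K).d + 2 : ℕ) : ℝ) * (422 + 1616 * (((F.P K).d + 2 : ℕ) : ℝ)) *
            ∑ i ∈ Finset.range (K - J), (((5 * F.L : ℕ) : ℝ) ^ 2 / 4) * θ (K - i)) *
        ((F.P K).L : ℝ) ^ (K - J) *
        ‖(fun ℓ : PBond (F.P K) 0 => if
            (B14.Eq22Determines.blockIter (K - J) ℓ.src = (bondShift (F.sitesPerDir_eq (m := F.m) (K := J) (j := 0) (m' := F.m) (K' := K) (j' := K - J) (by omega)) B).src ∨
              B14.Eq22Determines.blockIter (K - J) ℓ.src = (bondShift (F.sitesPerDir_eq (m := F.m) (K := J) (j := 0) (m' := F.m) (K' := K) (j' := K - J) (by omega)) B).tgt) ∧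
            (B14.Eq22Determines.blockIter (K - J) ℓ.tgt = (bondShift (F.sitesPerDir_eq (m := F.m) (K := J) (j := 0) (m' := F.m) (K' := K) (j' := K - J) (by omega)) B).src ∨
              B14.Eq22Determines.blockIter (K - J) ℓ.tgt = (bondShift (F.sitesPerDir_eq (m := F.m) (K := J) (j := 0) (m' := F.m) (K' := K) (j' := K - J) (by omega)) B).tgt)
          then y ℓ else 0)‖ := by
  rw [qfderiv_apply_eq_truncate (F := F) hJK hθ0 hθα hα24 hαδ hαL hUg y B]
  exact norm_qfderiv_apply_le (F := F) hJK hθ0 hθα hα24 hαδ hαL hUg _ B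

/-- ★★★ **SUMMED OVER COARSE BONDS**: `Σ_B ‖(DMq_{J←K}(U₀) y) B‖ ≤ (1 + 4(d+2))·exp(c₃·Σθ)·L^{K−J}·Σ_B ‖y^{(B)}‖_∞` — the propagation letter of a bracket field up the tower in the
«sum over coarse bonds of local sups» currency. [cite: Balaban1985Averaging, (15) p.19, (139)-(147) pp.39-40; Balaban1987RG1, (0.11) p.253] -/
theorem sum_norm_qfderiv_apply_le_local {J K : ℕ} (hJK : J ≤ K) {θ : ℕ → ℝ} (hθ0 : ∀ i, 0 ≤ θ i) {α : ℝ}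
    (hθα : ∀ i, J < i → i ≤ K → (((5 * F.L : ℕ) : ℝ) ^ 2 / 4) * θ i ≤ α)
    (hα24 : α ≤ 1 / 24) (hαδ : α < deltaSU (Fin 2)) (hαL : 157 * α < ((F.L : ℝ) ^ 2)⁻¹)
    {U₀ : GaugeField (F.P K) 0 (SU 2)} (hUg : U₀ ∈ histGood F ℰp θ K J)
    (y : PBond (F.P K) 0 → EuclideanSpace ℝ (Fin 3)) :
    ∑ B : PBond (F.P J) 0, ‖fderiv ℝ (fun (ζ : PBond (F.P K) 0 → EuclideanSpace ℝ (Fin 3)) (B : PBond (F.P J) 0) =>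
        imVec (su2Quat (descendTo F ℰp J K hJK (fun ℓ => expPoint (ζ ℓ) * U₀ ℓ) B * (descendTo F ℰp J K hJK U₀ B)⁻¹))) 0 y B‖ ≤
      (1 + 4 * (((F.P K).d + 2 : ℕ) : ℝ)) *
          Real.exp ((((F.P K).d + 2 : ℕ) : ℝ) * (422 + 1616 * (((F.P K).d + 2 : ℕ) : ℝ)) *
            ∑ i ∈ Finset.range (K - J), (((5 * F.L : ℕ) : ℝ) ^ 2 / 4) * θ (K - i)) *
        ((F.P K).L : ℝ) ^ (K - J) *
        ∑ B : PBond (F.P J) 0, ‖(fun ℓ : PBond (F.P K) 0 => if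
            (B14.Eq22Determines.blockIter (K - J) ℓ.src = (bondShift (F.sitesPerDir_eq (m := F.m) (K := J) (j := 0) (m' := F.m) (K' := K) (j' := K - J) (by omega)) B).src ∨
              B14.Eq22Determines.blockIter (K - J) ℓ.src = (bondShift (F.sitesPerDir_eq (m := F.m) (K := J) (j := 0) (m' := F.m) (K' := K) (j' := K - J) (by omega)) B).tgt) ∧
            (B14.Eq22Determines.blockIter (K - J) ℓ.tgt = (bondShift (F.sitesPerDir_eq (m := F.m) (K := J) (j := 0) (m' := F.m) (K' := K) (j' := K - J) (by omega)) B).src ∨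
              B14.Eq22Determines.blockIter (K - J) ℓ.tgt = (bondShift (F.sitesPerDir_eq (m := F.m) (K := J) (j := 0) (m' := F.m) (K' := K) (j' := K - J) (by omega)) B).tgt)
          then y ℓ else 0)‖ := by
  rw [Finset.mul_sum]
  exact Finset.sum_le_sum fun B _ => norm_qfderiv_apply_le_local (F := F) hJK hθ0 hθα hα24 hαδ hαL hUg y B

end LocalSup

end Summit.QuantumFields.YangMills.Theorems.FluctuationComparisonRegPrIntLS2BetaQuaternionReadDerivLocalSup

end
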